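import Mathlib.Algebra.Field.ZMod
import Mathlib.Tactic.LinearCombination
import Literature.Computability.AlgebraicComplexity.SingleProductExchange
import HarnessLib

/-!
# `R ≥ (3/2)·dim V` for the plane `span(1, N)` when `k[N]` acts without eigenvectors (field planes)

New work of the pub-omega census (ENG2 seat), topic `Summits/MatrixMultiplication/OmegaCensus`.
Framing: lottery ticket; floor = certified bounds/negative ranges. Kernel leg for ONE family of
numbers of a cap table (pub-omega-eng2/results/xcaps/DERIVATION.md, rule (G), 'field' plane):
not a result about ω.

Setting. `V` a finite-dimensional `k`-space, `N : V → V` linear with `N² = α·1 + β·N` and such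
that every nonzero element `c·1 + d·N` of the plane `L = span(1, N)` is injective on `V` (e.g.
`L ≅ 𝔽_{q²}` acting on `𝔽_{q²}^n`). The bilinear map `planeMul N : (s, v) ↦ s 0 • v + s 1 • N v`
is the restriction of the `2×2`-by-`2×n` matrix product to `X ∈ span(I, M)` when `V = k^{2×n}` and
`N` is left multiplication by a `2×2` matrix `M` with irreducible characteristic polynomial (the
'𝔽₉-orbit' of the 𝔽₃ tables: 18 of the 130 planes of `M₂(𝔽₃)`; the '𝔽₄-orbit' over 𝔽₂).

Theorem (`three_mul_finrank_le_two_mul_card`): every bilinear computation (Bläser 2003, Def. 1;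
tree structure `BilinComp`) of `planeMul N` has length `r` with `3·dim V ≤ 2r`; for `V = k^{2×n}`
this is `r ≥ 3n` (`three_mul_le_card_of_plane`), sharper than the DFS value 14 at `n = 5` over 𝔽₃.

Proof (ENG2's module argument, primal form). The second forms `g_i` have no common zero on
`V ∖ 0` (`φ(e₀, v) = v`). GREEDY: for a set `J` of products put
`A(J) = {v | g_j v = 0 ∧ g_j (N v) = 0 ∀ j ∈ J}`; it is `N`-stable (uses `N² ∈ span(1,N)`). If
`A(J) ≠ 0` pick `0 ≠ y₀ ∈ A(J)` and a product `t` with `a := g_t y₀ ≠ 0`; with `b := g_t (N y₀)`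
the images `(a, b)` of `y₀` and `(b, αa + γb)` of `N y₀ ∈ A(J)` under `v ↦ (g_t v, g_t (N v))` have
determinant `αa² + γab − b² = −a²·χ(b/a) ≠ 0`, so this map sends `A(J)` ONTO `k²`. So `dim A(J ∪ {t}) = dim A(J) − 2`, and we reach `A(J') = 0` with
`2|J'| = dim V`. Let `K = ⋂_{j∈J'} ker g_j` (`dim K ≥ dim V − |J'|`). Restricting the second
argument to `K` kills the products of `J'`; the remaining `r − |J'|` output vectors span a space
containing `φ(e₀,K) = K` and `φ(e₁,K) = N K`; `A(J') = 0` gives `K ∩ N K = 0` and `N` injective on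
`K`, so `r − |J'| ≥ 2 dim K ≥ 2 dim V − 2|J'| = dim V`, i.e. `r ≥ (3/2) dim V`.
-/

namespace Summit.MatrixMultiplication.OmegaCensus.SmallFormats

open Module Literature.Computability.AlgebraicComplexity

variable {k : Type*} [Field k]
variable {V : Type*} [AddCommGroup V] [Module k V]

/-- The plane product `φ(s, v) = s 0 • v + s 1 • N v` (`X = s 0 • 1 + s 1 • N ∈ span(1, N)`). -/
def planeMul (N : V →ₗ[k] V) : (Fin 2 → k) →ₗ[k] V →ₗ[k] V :=
  LinearMap.mk₂ k (fun s v => s 0 • v + s 1 • N v)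
    (fun s t v => by
      simp only [Pi.add_apply, add_smul]
      abel)
    (fun c s v => by
      simp only [Pi.smul_apply, smul_eq_mul, mul_smul, smul_add])
    (fun s v w => by
      simp only [map_add, smul_add]
      abel)
    (fun c s v => by
      simp only [map_smul, smul_comm (s 0) c, smul_comm (s 1) c, smul_add])

/-- Unfolding `planeMul`. -/
@[simp] theorem planeMul_apply (N : V →ₗ[k] V) (s : Fin 2 → k) (v : V) :
    planeMul N s v = s 0 • v + s 1 • N v := rfl

/-- `φ(e₀, v) = v`. -/
theorem planeMul_single_zero (N : V →ₗ[k] V) (v : V) : planeMul N (Pi.single 0 1) v = v := by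
  simp

/-- `φ(e₁, v) = N v`. -/
theorem planeMul_single_one (N : V →ₗ[k] V) (v : V) : planeMul N (Pi.single 1 1) v = N v := by
  simp

section Field

variable (N : V →ₗ[k] V) (α γ : k)

/-- The joint kernel `A(J) = {v | g_j v = 0 ∧ g_j (N v) = 0 for all j ∈ J}`. -/
def pairKer {ι : Type*} (g : ι → Module.Dual k V) (J : Finset ι) : Submodule k V :=
  ⨅ j ∈ J, (LinearMap.ker (g j) ⊓ LinearMap.ker ((g j).comp N))

/-- Membership in `pairKer`. -/
theorem mem_pairKer {ι : Type*} (g : ι → Module.Dual k V) (J : Finset ι) (v : V) :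
    v ∈ pairKer N g J ↔ ∀ j ∈ J, g j v = 0 ∧ g j (N v) = 0 := by
  simp [pairKer, Submodule.mem_iInf]

/-- `A(J)` is `N`-stable when `N² = α·1 + γ·N`. -/
theorem pairKer_map_mem {ι : Type*} (hN2 : N.comp N = α • (LinearMap.id : V →ₗ[k] V) + γ • N)
    (g : ι → Module.Dual k V) (J : Finset ι) {v : V} (hv : v ∈ pairKer N g J) :
    N v ∈ pairKer N g J := by
  rw [mem_pairKer] at hv ⊢
  intro j hj
  obtain ⟨h1, h2⟩ := hv j hj
  refine ⟨h2, ?_⟩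
  have : N (N v) = α • v + γ • N v := by
    have := congrArg (fun f => f v) hN2
    simpa using this
  rw [this, map_add, map_smul, map_smul, h1, h2]
  simp

/-- GREEDY STEP. If `A(J) ≠ 0`, some product `t` cuts it down by two dimensions. Hypotheses:
`N² = α·1 + γ·N` and `t² ≠ γ t + α` for all `t ∈ k` (the plane `span(1, N)` has no eigenvalue). -/
theorem exists_pairKer_insert [FiniteDimensional k V] {ι : Type*} [Fintype ι] [DecidableEq ι]
    (hN2 : N.comp N = α • (LinearMap.id : V →ₗ[k] V) + γ • N) (hχ : ∀ t : k, t * t ≠ γ * t + α)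
    (β : BilinComp (planeMul N) ι) (J : Finset ι) (hA : pairKer N β.g J ≠ ⊥) :
    ∃ t, finrank k (pairKer N β.g (insert t J)) + 2 = finrank k (pairKer N β.g J) := by
  classical
  set A := pairKer N β.g J with hAdef
  -- a nonzero `y₀ ∈ A` and a product `t` with `g_t y₀ ≠ 0`
  obtain ⟨y₀, hy₀A, hy₀⟩ := (Submodule.ne_bot_iff A).1 hA
  have hex : ∃ t, β.g t y₀ ≠ 0 := by
    by_contra h
    simp only [not_exists, not_not] at h
    have hsum := β.map_eq_sum (Pi.single 0 1) y₀
    rw [planeMul_single_zero] at hsum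
    apply hy₀
    rw [hsum]
    exact Finset.sum_eq_zero fun i _ => by simp [h i]
  obtain ⟨t, ht⟩ := hex
  refine ⟨t, ?_⟩
  have hNA : ∀ v ∈ A, N v ∈ A := fun v hv => pairKer_map_mem N α γ hN2 β.g J hv
  have hNN : ∀ v : V, N (N v) = α • v + γ • N v := by
    intro v
    have := congrArg (fun f => f v) hN2
    simpa using this
  -- `Ψ : A → k², v ↦ (g_t v, g_t (N v))`
  let Ψ : A →ₗ[k] (Fin 2 → k) :=
    LinearMap.pi fun i : Fin 2 =>
      if i = 0 then (β.g t).comp A.subtype else ((β.g t).comp N).comp A.subtype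
  have hΨ0 : ∀ v : A, Ψ v 0 = β.g t v := fun v => by simp [Ψ]
  have hΨ1 : ∀ v : A, Ψ v 1 = β.g t (N v) := fun v => by simp [Ψ]
  -- the images of `y₀` and `N y₀` span `k²`: their determinant is `−a² χ(b/a) ≠ 0`
  set a := β.g t y₀ with ha
  set b := β.g t (N y₀) with hb
  have hD : a * (α * a + γ * b) - b * b ≠ 0 := by
    intro hD
    apply hχ (b / a)
    field_simp
    linear_combination (-1 : k) * hD
  have hsurj : Function.Surjective Ψ := by
    intro w
    set D := a * (α * a + γ * b) - b * b with hDdef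
    let x : k := (w 0 * (α * a + γ * b) - w 1 * b) / D
    let y : k := (a * w 1 - b * w 0) / D
    refine ⟨⟨x • y₀ + y • N y₀, A.add_mem (A.smul_mem x hy₀A) (A.smul_mem y (hNA y₀ hy₀A))⟩, ?_⟩
    funext i
    by_cases h : i = 0
    · subst h
      rw [hΨ0]
      simp only [map_add, map_smul, smul_eq_mul]
      rw [← ha, ← hb]
      simp only [x, y]
      field_simp
      ring
    · have h1 : i = 1 := by omega
      subst h1
      rw [hΨ1]
      simp only [map_add, map_smul, hNN, smul_eq_mul]
      rw [← ha, ← hb]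
      simp only [x, y]
      field_simp
      ring
  -- rank–nullity for `Ψ`
  have hker : finrank k (LinearMap.ker Ψ) + 2 = finrank k A := by
    have h1 := LinearMap.finrank_range_add_finrank_ker Ψ
    rw [LinearMap.range_eq_top.2 hsurj, finrank_top, Module.finrank_fintype_fun_eq_card,
      Fintype.card_fin] at h1
    omega
  -- `ker Ψ`, pushed into `V`, is `pairKer (insert t J)`
  have hmap : (LinearMap.ker Ψ).map A.subtype = pairKer N β.g (insert t J) := by
    ext v
    constructor
    · rintro ⟨u, hu, rfl⟩
      have hu' : Ψ u = 0 := hu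
      rw [mem_pairKer]
      intro j hj
      rcases Finset.mem_insert.1 hj with rfl | hj
      · exact ⟨by simpa [hΨ0] using congrFun hu' 0, by simpa [hΨ1] using congrFun hu' 1⟩
      · exact (mem_pairKer N β.g J _).1 u.2 j hj
    · intro hv
      have hvJ : v ∈ A := by
        rw [hAdef, mem_pairKer]
        intro j hj
        exact (mem_pairKer N β.g _ _).1 hv j (Finset.mem_insert_of_mem hj)
      have hvt := (mem_pairKer N β.g _ _).1 hv t (Finset.mem_insert_self t J)
      refine ⟨⟨v, hvJ⟩, ?_, rfl⟩
      show Ψ ⟨v, hvJ⟩ = 0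
      funext i
      by_cases h : i = 0
      · subst h; simpa [hΨ0] using hvt.1
      · have h1 : i = 1 := by omega
        subst h1; simpa [hΨ1] using hvt.2
  have hiso : finrank k (LinearMap.ker Ψ) = finrank k (pairKer N β.g (insert t J)) := by
    rw [← hmap, Submodule.finrank_map_subtype_eq]
  omega

/-- GREEDY: some `J'` with `A(J') = 0` and `2|J'| = dim V`. -/
theorem exists_pairKer_eq_bot [FiniteDimensional k V] {ι : Type*} [Fintype ι] [DecidableEq ι]
    (hN2 : N.comp N = α • (LinearMap.id : V →ₗ[k] V) + γ • N) (hχ : ∀ t : k, t * t ≠ γ * t + α)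
    (β : BilinComp (planeMul N) ι) :
    ∃ J' : Finset ι, pairKer N β.g J' = ⊥ ∧
      finrank k (pairKer N β.g J') + 2 * J'.card = finrank k V := by
  classical
  suffices h : ∀ m (J : Finset ι), finrank k (pairKer N β.g J) = m →
      finrank k (pairKer N β.g J) + 2 * J.card = finrank k V →
      ∃ J' : Finset ι, pairKer N β.g J' = ⊥ ∧
        finrank k (pairKer N β.g J') + 2 * J'.card = finrank k V by
    refine h _ ∅ rfl ?_
    have : pairKer N β.g (∅ : Finset ι) = ⊤ := by
      ext v; simp [mem_pairKer]
    rw [this, finrank_top]; simp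
  intro m
  induction m using Nat.strong_induction_on with
  | _ m ih =>
    intro J hm hinv
    by_cases hbot : pairKer N β.g J = ⊥
    · exact ⟨J, hbot, hinv⟩
    · obtain ⟨t, ht⟩ := exists_pairKer_insert N α γ hN2 hχ β J hbot
      have htJ : t ∉ J := by
        intro htJ
        rw [Finset.insert_eq_of_mem htJ] at ht
        omega
      have hcard : (insert t J).card = J.card + 1 := Finset.card_insert_of_notMem htJ
      exact ih (finrank k (pairKer N β.g (insert t J))) (by omega) (insert t J) rfl (by omega)

/-- **Field-plane bound.** If `N² = α·1 + γ·N` and `t² − γ t − α` has no root in `k`, every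
bilinear computation of `planeMul N` has length `r` with `3 dim V ≤ 2 r`. -/
theorem three_mul_finrank_le_two_mul_card [FiniteDimensional k V] {ι : Type*} [Fintype ι]
    [DecidableEq ι]
    (hN2 : N.comp N = α • (LinearMap.id : V →ₗ[k] V) + γ • N) (hχ : ∀ t : k, t * t ≠ γ * t + α)
    (β : BilinComp (planeMul N) ι) : 3 * finrank k V ≤ 2 * Fintype.card ι := by
  classical
  obtain ⟨J', hA, hcardJ'⟩ := exists_pairKer_eq_bot N α γ hN2 hχ β
  rw [hA, finrank_bot, zero_add] at hcardJ'
  -- `K = ⋂_{j ∈ J'} ker g_j`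
  let T : V →ₗ[k] (J' → k) := LinearMap.pi fun j => β.g j
  let K : Submodule k V := LinearMap.ker T
  have hmemK : ∀ {v}, v ∈ K ↔ ∀ j ∈ J', β.g j v = 0 := by
    intro v
    constructor
    · intro hv j hj
      have := congrFun (LinearMap.mem_ker.1 hv) ⟨j, hj⟩
      simpa [T] using this
    · intro h
      rw [LinearMap.mem_ker]
      funext j
      simpa [T] using h j j.2
  have hKdim : finrank k V ≤ finrank k K + J'.card := by
    have h1 : finrank k (LinearMap.range T) + finrank k K = finrank k V :=
      LinearMap.finrank_range_add_finrank_ker T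
    have h2 : finrank k (LinearMap.range T) ≤ finrank k (J' → k) := Submodule.finrank_le _
    have h3 : finrank k (J' → k) = J'.card := by
      rw [Module.finrank_fintype_fun_eq_card, Fintype.card_coe]
    omega
  -- `y ∈ K`, `N y ∈ K` ⇒ `y ∈ A(J') = 0`
  have hKN : ∀ y ∈ K, N y ∈ K → y = 0 := by
    intro y hy hNy
    have : y ∈ pairKer N β.g J' := by
      rw [mem_pairKer]
      exact fun j hj => ⟨hmemK.1 hy j hj, hmemK.1 hNy j hj⟩
    rw [hA] at this
    exact (Submodule.mem_bot k).1 this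
  -- kill the products of `J'`
  have hJK : ∀ i ∈ J', ∀ u ∈ K, β.flip.f i u = 0 := by
    intro i hi u hu
    rw [BilinComp.flip_f]
    exact hmemK.1 hu i hi
  let β' := β.flip.restrictDrop K J' hJK
  let S : Submodule k V := Submodule.span k (Set.range β'.w)
  have hval : ∀ (y : K) (s : Fin 2 → k), planeMul N s (y : V) ∈ S := by
    intro y s
    have h := β'.map_eq_sum y s
    have h' : ((planeMul N).flip.comp K.subtype) y s = planeMul N s y := rfl
    rw [h'] at h
    rw [h]
    exact Submodule.sum_mem _ fun i _ =>
      Submodule.smul_mem _ _ (Submodule.subset_span ⟨i, rfl⟩)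
  have hKS : K ≤ S := by
    intro y hy
    have := hval ⟨y, hy⟩ (Pi.single 0 1)
    rwa [planeMul_single_zero] at this
  have hNKS : K.map N ≤ S := by
    rintro _ ⟨y, hy, rfl⟩
    have := hval ⟨y, hy⟩ (Pi.single 1 1)
    rwa [planeMul_single_one] at this
  have hKNK : K ⊓ K.map N = ⊥ := by
    rw [eq_bot_iff]
    rintro z ⟨hzK, ⟨y, hy, rfl⟩⟩
    rw [Submodule.mem_bot]
    have : y = 0 := hKN y hy hzK
    rw [this, map_zero]
  have hNinj : Function.Injective (N.domRestrict K) := by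
    rw [← LinearMap.ker_eq_bot, eq_bot_iff]
    intro y hy
    rw [Submodule.mem_bot]
    have hy0 : N y = 0 := by simpa using hy
    have : (y : V) = 0 := hKN y y.2 (by rw [hy0]; exact K.zero_mem)
    exact Subtype.ext this
  have hmapdim : finrank k (K.map N) = finrank k K := by
    rw [← LinearMap.range_domRestrict]
    exact LinearMap.finrank_range_of_inj hNinj
  have hsup : finrank k ↥(K ⊔ K.map N) = finrank k K + finrank k (K.map N) := by
    have := Submodule.finrank_sup_add_finrank_inf_eq K (K.map N)
    rw [hKNK, finrank_bot] at this
    omega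
  have hsupS : finrank k ↥(K ⊔ K.map N) ≤ finrank k S :=
    Submodule.finrank_mono (sup_le hKS hNKS)
  have hS : finrank k S ≤ Fintype.card {i // i ∉ J'} := finrank_range_le_card β'.w
  have hcard : Fintype.card {i // i ∉ J'} = Fintype.card ι - J'.card :=
    BilinComp.card_restrictDrop_index J'
  have hJ'card : J'.card ≤ Fintype.card ι := Finset.card_le_univ J'
  omega

end Field

/-! ## The `2×n` matrix instance: `X ∈ span(I, M)`, `M² = α I + γ M` with no eigenvalue -/

/-- Left multiplication of a `2×n` matrix by the `2×2` matrix `M = !![0, 1; α, γ]`: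
`(N Y) 0 = Y 1`, `(N Y) 1 = α • Y 0 + γ • Y 1` (companion matrix of `t² − γ t − α`). -/
def companionShift (n : ℕ) (α γ : k) : (Fin 2 → Fin n → k) →ₗ[k] (Fin 2 → Fin n → k) where
  toFun Y i := if i = 0 then Y 1 else α • Y 0 + γ • Y 1
  map_add' Y Z := by
    funext i
    by_cases h : i = 0
    · simp [h]
    · simp only [h, if_false, Pi.add_apply, smul_add]
      abel
  map_smul' c Y := by
    funext i
    by_cases h : i = 0
    · simp [h]
    · simp only [h, if_false, Pi.smul_apply, smul_add, RingHom.id_apply, smul_smul, mul_comm c]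

/-- `(N Y) 0 = Y 1`. -/
@[simp] theorem companionShift_zero (n : ℕ) (α γ : k) (Y : Fin 2 → Fin n → k) :
    companionShift n α γ Y 0 = Y 1 := by simp [companionShift]

/-- `(N Y) 1 = α Y 0 + γ Y 1`. -/
@[simp] theorem companionShift_one (n : ℕ) (α γ : k) (Y : Fin 2 → Fin n → k) :
    companionShift n α γ Y 1 = α • Y 0 + γ • Y 1 := by simp [companionShift]

/-- Cayley–Hamilton for the companion matrix: `N² = α·1 + γ·N`. -/
theorem companionShift_sq (n : ℕ) (α γ : k) :
    (companionShift n α γ).comp (companionShift n α γ)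
      = α • (LinearMap.id : (Fin 2 → Fin n → k) →ₗ[k] (Fin 2 → Fin n → k)) + γ • companionShift (k := k) n α γ := by
  apply LinearMap.ext
  intro Y
  funext i j
  by_cases h : i = 0
  · subst h; simp
  · have h1 : i = 1 := by omega
    subst h1
    simp only [LinearMap.comp_apply, LinearMap.add_apply, LinearMap.smul_apply, LinearMap.id_apply,
      Pi.add_apply, Pi.smul_apply, smul_eq_mul, companionShift_one, companionShift_zero]

/-- `dim k^{2×n} = 2n`. -/
theorem finrank_two_by' (n : ℕ) : finrank k (Fin 2 → Fin n → k) = 2 * n := by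
  rw [Module.finrank_pi_fintype k]
  simp [Finset.sum_const]

/-- **`R(⟨2,2,n⟩ | X ∈ span(I, M)) ≥ 3n` for `M = !![0,1;α,γ]` without eigenvalues** (`t² ≠ γt + α`
for all `t ∈ k`): every bilinear computation of `planeMul (companionShift n α γ)` (`= (X, Y) ↦ XY`
for `X ∈ span(I, M)`, `Y ∈ k^{2×n}`) has at least `3n` products. -/
theorem three_mul_le_card_of_plane (n : ℕ) (α γ : k) (hχ : ∀ t : k, t * t ≠ γ * t + α)
    {ι : Type*} [Fintype ι] [DecidableEq ι]
    (β : BilinComp (planeMul (companionShift (k := k) n α γ)) ι) : 3 * n ≤ Fintype.card ι := by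
  have h := three_mul_finrank_le_two_mul_card (companionShift n α γ) α γ
    (companionShift_sq n α γ) hχ β
  rw [finrank_two_by'] at h
  omega

/-- `t² + 1` has no root in 𝔽₃ (as `t·t ≠ 0·t + 2`). -/
theorem zmod3_sq_ne : ∀ t : ZMod 3, t * t ≠ 0 * t + 2 := by decide

/-- `t² + t + 1` has no root in 𝔽₂ (as `t·t ≠ 1·t + 1`). -/
theorem zmod2_sq_ne : ∀ t : ZMod 2, t * t ≠ 1 * t + 1 := by decide

/-- **𝔽₃, '𝔽₉-orbit'**: every bilinear computation of `X·Y`, `X ∈ span(I, !![0,1;2,0]) ⊂ M₂(𝔽₃)`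
(`M² = −I`, `t² + 1` irreducible over 𝔽₃), `Y ∈ 𝔽₃^{2×n}`, has at least `3n` products — the
census cap '𝔽₉-line ≤ r − 3n' (sharper than the DFS value `r − (3n−1)` used so far at `n = 5`). -/
theorem three_mul_le_card_F9plane [Fact (Nat.Prime 3)] (n : ℕ) {ι : Type*} [Fintype ι]
    [DecidableEq ι] (β : BilinComp (planeMul (companionShift (k := ZMod 3) n 2 0)) ι) :
    3 * n ≤ Fintype.card ι :=
  three_mul_le_card_of_plane n 2 0 zmod3_sq_ne β

/-- **𝔽₂, '𝔽₄-orbit'**: the same for `X ∈ span(I, !![0,1;1,1]) ⊂ M₂(𝔽₂)` (`t² + t + 1` irreducible). -/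
theorem three_mul_le_card_F4plane [Fact (Nat.Prime 2)] (n : ℕ) {ι : Type*} [Fintype ι]
    [DecidableEq ι] (β : BilinComp (planeMul (companionShift (k := ZMod 2) n 1 1)) ι) :
    3 * n ≤ Fintype.card ι :=
  three_mul_le_card_of_plane n 1 1 zmod2_sq_ne β

end Summit.MatrixMultiplication.OmegaCensus.SmallFormats
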